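import Summits.CriticalPhenomena.PercolationContinuityZ3.Theorems.PercNearOneGluingAdditiveGluingGoodStepDriftFree
import Summits.CriticalPhenomena.PercolationContinuityZ3.Theorems.PercNearOneGluingAdditiveGluingBlockGoodTwoRelays
import HarnessLib

/-! # Crux `PercNearOneGluing.AdditiveGluing` (stmt-CriticalPhenomena-4576), stub `stub_goodStep` — reduction to the RESIDUAL kernel

Stub-plan prover; lands `--supports stmt-CriticalPhenomena-4576`; no definitions, no named facts.

**`goodStep_of_residualKernel`** (registered `stub_goodStepOfResidualKernel_sp`): the inductive step `stub_goodStep` (verbatim) follows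
from the block-goodness kernel restricted to the RESIDUE left by this session's theorems — a BAD block `S` (`|S| ≥ 2`, every vertex less
reliable than the designated relay `a₀ = argmin_A μ_u(· ↔ b)`), at least THREE relays besides the target (`4 ≤ A.card`), and DRIFT
(`a₀` is no longer a minimiser of the glued two-point function `μ_{u/S}(· ↔ b)`):
`μ(a₀↔b) + μ(a₀↮b, a₀↔S, S↔b) ≤ μ(S↔b) + Σ_{W∩A=∅} μ(K_S = W)·μ(sel W ↔ b in Wᶜ)` for such `(u, A, S, b, a₀, sel)` only.
Proof: `goodStep24_main`; a kernel instance with `A.card ≤ 3` is the drift theorem `blockGood_cardLeThree`; one without drift is the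
induction hypothesis for the glued quadruple (`blockGood_leaf_ih`, `driftFree_card_lt`); the rest is the hypothesis.  The residue contains
Kozma–Nitzan's Question 7 for three relays. [cite: KozmaNitzan2024, §3.2 (Thms 4–5 pp. 12–14, Question 7 p. 36)]
-/

namespace Summit.CriticalPhenomena.PercolationContinuityZ3.Theorems

open MeasureTheory Set
open Literature.Probability.LatticeModels (prodBernoulli)
open Literature.Probability.Percolation (BondConfig openConn openConnIn openGraph openCluster)
open scoped BigOperators

noncomputable section
open Classical

section Residual

open Literature.Probability.LatticeModels Literature.Probability.Percolation

variable {n : ℕ}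

/-- **`stub_goodStep` from the residual kernel (bad block, ≥ 3 relays, drift).**  See the module docstring.
[cite: KozmaNitzan2024, §3.2 (Thms 4–5 pp. 12–14, Question 7 p. 36)] -/
theorem goodStep_of_residualKernel
    (hres : ∀ (n : ℕ) (u : Sym2 (Fin n) → unitInterval) (A S : Finset (Fin n)) (b a₀ : Fin n)
      (sel : Finset (Fin n) → Fin n),
      b ∈ A → Disjoint S A → 2 ≤ S.card → 4 ≤ A.card → (∀ W, sel W ∈ A) → a₀ ∈ A →
      (∀ a ∈ A, (prodBernoulli u).real (openConn a₀ b) ≤ (prodBernoulli u).real (openConn a b)) →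
      (∀ v ∈ S, (prodBernoulli u).real (openConn v b) < (prodBernoulli u).real (openConn a₀ b)) →
      (∃ a ∈ A, (prodBernoulli (fun e : Sym2 (Fin n) =>
          if (∀ x ∈ e, x ∈ S) ∧ ¬ e.IsDiag then 1 else u e)).real (openConn a b) <
        (prodBernoulli (fun e : Sym2 (Fin n) => if (∀ x ∈ e, x ∈ S) ∧ ¬ e.IsDiag then 1 else u e)).real (openConn a₀ b)) →
      (prodBernoulli u).real (openConn a₀ b)
          + (prodBernoulli u).real ((openConn a₀ b)ᶜ ∩ (⋃ s ∈ S, openConn a₀ s) ∩ (⋃ s ∈ S, openConn s b))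
        ≤ (prodBernoulli u).real (⋃ s ∈ S, openConn s b)
          + ∑ W ∈ (Finset.univ : Finset (Finset (Fin n))).filter (fun W => Disjoint W A),
              (prodBernoulli u).real {ω : BondConfig (Fin n) | ∀ z : Fin n, (z ∈ W ↔ ω ∈ ⋃ s ∈ S, openConn s z)}
                * (prodBernoulli u).real (openConnIn ((W : Set (Fin n))ᶜ) (sel W) b)) :
    ∀ (n : ℕ) (w : Sym2 (Fin n) → unitInterval) (A : Finset (Fin n)) (o b : Fin n),
      b ∈ A → o ∉ A →
      (∃ y : Fin n, y ∉ A ∧ y ≠ o ∧ (w s(o, y) : ℝ) ≠ 0) →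
      (∀ w' : Sym2 (Fin n) → unitInterval,
        (Finset.univ.filter (fun v : Fin n => ∃ u : Fin n, 0 < (w' s(u, v) : ℝ))).card
          < (Finset.univ.filter (fun v : Fin n => ∃ u : Fin n, 0 < (w s(u, v) : ℝ))).card →
        ∀ (A' : Finset (Fin n)) (o' b' : Fin n), b' ∈ A' → o' ∉ A' →
        ∀ (t : ℝ) (sel : Finset (Fin n) → Fin n), (∀ W, sel W ∈ A') →
          (∀ a ∈ A', 1 - t ≤ (prodBernoulli w').real (openConn a b')) →
          (prodBernoulli w').real ((⋃ a ∈ A', openConn o' a) ∩ (openConn o' b')ᶜ)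
            + ∑ W ∈ (Finset.univ : Finset (Finset (Fin n))).filter (fun W => o' ∈ W ∧ Disjoint W A'),
                (prodBernoulli w').real {ω : BondConfig (Fin n) | openCluster ω o' = (W : Set (Fin n))}
                  * (prodBernoulli w').real (openConnIn ((W : Set (Fin n))ᶜ) (sel W) b')ᶜ
            ≤ t) →
      ∀ (t : ℝ) (sel : Finset (Fin n) → Fin n), (∀ W, sel W ∈ A) →
        (∀ a ∈ A, 1 - t ≤ (prodBernoulli w).real (openConn a b)) →
        (prodBernoulli w).real ((⋃ a ∈ A, openConn o a) ∩ (openConn o b)ᶜ)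
          + ∑ W ∈ (Finset.univ : Finset (Finset (Fin n))).filter (fun W => o ∈ W ∧ Disjoint W A),
              (prodBernoulli w).real {ω : BondConfig (Fin n) | openCluster ω o = (W : Set (Fin n))}
                * (prodBernoulli w).real (openConnIn ((W : Set (Fin n))ᶜ) (sel W) b)ᶜ
          ≤ t := by
  intro n w A o b hb ho hlow IH
  obtain ⟨y₀, -, -, hy₀⟩ := id hlow
  refine goodStep24_main n w A o b hb ho hlow IH ?_
  intro S sel a₀ h2 hoS hSA hSw hsel ha₀ hmin hbad
  set K : Sym2 (Fin n) → unitInterval := fun e => if o ∈ e then (0 : unitInterval) else w e with hK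
  obtain ⟨s₀, hs₀⟩ := Finset.card_pos.1 (lt_of_lt_of_le zero_lt_two h2)
  have hs₀A : s₀ ∉ A := Finset.disjoint_left.1 hSA hs₀
  -- the goal in un-glued form (H3)
  rw [blockGrowth_glue_real_openConn, blockGrowth_glue_real_iUnion K S b]
  simp only [blockGrowth_glue_real_pocket K S]
  by_cases hA3 : A.card ≤ 3
  · -- at most two relays besides the target: the drift theorem
    exact blockGood_cardLeThree K A S b a₀ (fun W' => sel (insert o W')) hb ha₀ hA3 ⟨s₀, hs₀⟩ (fun W' => hsel _) hmin
  by_cases hfree : ∀ a ∈ A, (prodBernoulli (fun e : Sym2 (Fin n) =>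
      if (∀ x ∈ e, x ∈ S) ∧ ¬ e.IsDiag then 1 else K e)).real (openConn a₀ b) ≤
    (prodBernoulli (fun e : Sym2 (Fin n) => if (∀ x ∈ e, x ∈ S) ∧ ¬ e.IsDiag then 1 else K e)).real (openConn a b)
  · -- no drift: the induction hypothesis for the glued quadruple
    have hgood := IH (fun e : Sym2 (Fin n) => if (∀ x ∈ e, x ∈ S) ∧ ¬ e.IsDiag then 1 else K e)
      (driftFree_card_lt w S o y₀ hoS hy₀ hSw) A s₀ b hb hs₀A
    exact blockGood_leaf_ih K A S b a₀ s₀ (fun W' => sel (insert o W')) hs₀ hb (fun W' => hsel _) hfree hgood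
  · -- the residue
    push Not at hA3 hfree
    obtain ⟨a, ha, hlt⟩ := hfree
    exact hres n K A S b a₀ (fun W' => sel (insert o W')) hb hSA h2 (by omega) (fun W' => hsel _) ha₀ hmin hbad
      ⟨a, ha, hlt⟩

end Residual

open Literature.Probability.LatticeModels Literature.Probability.Percolation in
/-- Registered helper stub `stub_goodStepOfResidualKernel_sp` (stub-plan prover, capstone): `stub_goodStep` ⟸ the block kernel on the
RESIDUE only — bad block, at least three relays besides the target, and drift (= `goodStep_of_residualKernel`).
[cite: KozmaNitzan2024, §3.2 (Thms 4–5 pp. 12–14, Question 7 p. 36)] -/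
theorem stub_goodStepOfResidualKernel_sp : (∀ (n : ℕ) (u : Sym2 (Fin n) → unitInterval) (A S : Finset (Fin n)) (b a₀ : Fin n) (sel : Finset (Fin n) → Fin n), b ∈ A → Disjoint S A → 2 ≤ S.card → 4 ≤ A.card → (∀ W, sel W ∈ A) → a₀ ∈ A → (∀ a ∈ A, (prodBernoulli u).real (openConn a₀ b) ≤ (prodBernoulli u).real (openConn a b)) → (∀ v ∈ S, (prodBernoulli u).real (openConn v b) < (prodBernoulli u).real (openConn a₀ b)) → (∃ a ∈ A, (prodBernoulli (fun e : Sym2 (Fin n) => if (∀ x ∈ e, x ∈ S) ∧ ¬ e.IsDiag then 1 else u e)).real (openConn a b) < (prodBernoulli (fun e : Sym2 (Fin n) => if (∀ x ∈ e, x ∈ S) ∧ ¬ e.IsDiag then 1 else u e)).real (openConn a₀ b)) → (prodBernoulli u).real (openConn a₀ b) + (prodBernoulli u).real ((openConn a₀ b)ᶜ ∩ (⋃ s ∈ S, openConn a₀ s) ∩ (⋃ s ∈ S, openConn s b)) ≤ (prodBernoulli u).real (⋃ s ∈ S, openConn s b) + ∑ W ∈ (Finset.univ : Finset (Finset (Fin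 n))).filter (fun W => Disjoint W A), (prodBernoulli u).real {ω : BondConfig (Fin n) | ∀ z : Fin n, (z ∈ W ↔ ω ∈ ⋃ s ∈ S, openConn s z)} * (prodBernoulli u).real (openConnIn ((W : Set (Fin n))ᶜ) (sel W) b)) → ∀ (n : ℕ) (w : Sym2 (Fin n) → unitInterval) (A : Finset (Fin n)) (o b : Fin n), b ∈ A → o ∉ A → (∃ y : Fin n, y ∉ A ∧ y ≠ o ∧ (w s(o, y) : ℝ) ≠ 0) → (∀ w' : Sym2 (Fin n) → unitInterval, (Finset.univ.filter (fun v : Fin n => ∃ u : Fin n, 0 < (w' s(u, v) : ℝ))).card < (Finset.univ.filter (fun v : Fin n => ∃ u : Fin n, 0 < (w s(u, v) : ℝ))).card → ∀ (A' : Finset (Fin n)) (o' b' : Fin n), b' ∈ A' → o' ∉ A' → ∀ (t : ℝ) (sel : Finset (Fin n) → Fin n), (∀ W, sel W ∈ A') → (∀ a ∈ A', 1 - t ≤ (prodBernoulli w').real (openConn a b')) → (prodBernoulli w').real ((⋃ a ∈ A', openConn o' a) ∩ (openConn o' b')ᶜ) + ∑ W ∈ (Finset.univ : Finset (Finset (Fin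 n))).filter (fun W => o' ∈ W ∧ Disjoint W A'), (prodBernoulli w').real {ω : BondConfig (Fin n) | openCluster ω o' = (W : Set (Fin n))} * (prodBernoulli w').real (openConnIn ((W : Set (Fin n))ᶜ) (sel W) b')ᶜ ≤ t) → ∀ (t : ℝ) (sel : Finset (Fin n) → Fin n), (∀ W, sel W ∈ A) → (∀ a ∈ A, 1 - t ≤ (prodBernoulli w).real (openConn a b)) → (prodBernoulli w).real ((⋃ a ∈ A, openConn o a) ∩ (openConn o b)ᶜ) + ∑ W ∈ (Finset.univ : Finset (Finset (Fin n))).filter (fun W => o ∈ W ∧ Disjoint W A), (prodBernoulli w).real {ω : BondConfig (Fin n) | openCluster ω o = (W : Set (Fin n))} * (prodBernoulli w).real (openConnIn ((W : Set (Fin n))ᶜ) (sel W) b)ᶜ ≤ t :=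
  goodStep_of_residualKernel

end

end Summit.CriticalPhenomena.PercolationContinuityZ3.Theorems
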